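import Literature.Geometry.Lorentzian.InitialDataLocality
import Literature.Geometry.Lorentzian.InitialDataDilation
import Literature.Geometry.Lorentzian.LeviCivitaProofs
import HarnessLib

/-!
# `KerrShieldedDataExist`, line `plug-the-second-sheet` — the assembly, II: gluing initial data sets on
# `E3` from local models

Support file (everything proved; no definitions, no named facts) for stub `stub_assembly` of crux
`stmt-FinalStateConjecture-10055`. The glued datum of the assembly is given by two TOTAL fields of
bilinear forms `(h, k)` on `E3` (defined zone-wise by radial case distinction); this file turns such a
pair into a smooth `InitialDataSet (𝓡 3) E3` solving the vacuum constraints, given LOCAL MODELS: every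
point has a neighbourhood `W`, contained in a chart domain `U ⊆ E3`, and a vacuum initial data set on `U`
whose sections agree with `(h, k)` on `W`.

* `exists_initialDataSet_of_localData` — smoothness of the glued sections is read off the models
  (`OpensChart.contMDiffAt_bilinSection_iff`, `contMDiffAt_bilinE3_iff`: over chart domains bundle
  smoothness is plain smoothness), positivity/symmetry pointwise, and the vacuum constraints at `y`
  transfer from the model through the inclusion `U ⊆ E3` (`InitialDataSet.isVacuumAt_comap_iff`,
  `isVacuumAt_congr`: the constraint map is local and diffeomorphism-equivariant, Bartnik–Isenberg 2004, §2).

References: R. Bartnik, J. Isenberg, *The constraint equations* (2004), §2; J. Corvino, Comm. Math. Phys. 214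
(2000), §4 (patching data agreeing on overlaps).
-/

-- the doubled `FinalStateConjecture` path component is the summit/problem naming scheme, not a mistake
set_option linter.dupNamespace false

noncomputable section

open Set Filter Topology TopologicalSpace Bundle
open scoped Manifold ContDiff Topology
open Literature.Geometry.Lorentzian
open Literature.Geometry.Manifold (OpenSubmanifold.mfderiv_subtype_val)

namespace Summit.FinalStateConjecture.FinalStateConjecture.Theorems.SwallowTheDatum

namespace Assembly

section Glue

variable {hF kF : E3 → E3 →L[ℝ] E3 →L[ℝ] ℝ}

/-- A total field of bilinear forms on `E3` which agrees, on an open neighbourhood `W ⊆ U` of `y`, with the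
metric of an initial data set on the chart domain `U` is `C^∞` at `y` (as a map `E3 → (E3 →L E3 →L ℝ)`).
[folklore] -/
theorem contDiffAt_of_localData_h {y : E3} {U : Opens E3} (DU : InitialDataSet 𝓘(ℝ, E3) U) {W : Set E3}
    (hWo : IsOpen W) (hyW : y ∈ W) (hWU : W ⊆ U)
    (hag : ∀ z (hz : z ∈ U), z ∈ W → ∀ v w, hF z v w = DU.h.inner ⟨z, hz⟩ v w) :
    ContDiffAt ℝ ∞ hF y := by
  have hyU : y ∈ U := hWU hyW
  have hG : ContDiffAt ℝ ∞ DU.coordHOn y :=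
    (OpensChart.contMDiffAt_bilinSection_iff ⟨y, hyU⟩ DU.h.inner DU.coordHOn
      (fun z ↦ (DU.coordHOn_of_mem z.2).symm)).1 (DU.h.contMDiff ⟨y, hyU⟩)
  refine hG.congr_of_eventuallyEq ?_
  filter_upwards [hWo.mem_nhds hyW] with z hz
  ext v w
  rw [hag z (hWU hz) hz v w, DU.coordHOn_of_mem (hWU hz)]
  rfl

/-- The same for the tensor `k`. [folklore] -/
theorem contDiffAt_of_localData_k {y : E3} {U : Opens E3} (DU : InitialDataSet 𝓘(ℝ, E3) U) {W : Set E3}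
    (hWo : IsOpen W) (hyW : y ∈ W) (hWU : W ⊆ U)
    (hag : ∀ z (hz : z ∈ U), z ∈ W → ∀ v w, kF z v w = DU.k ⟨z, hz⟩ v w) :
    ContDiffAt ℝ ∞ kF y := by
  have hyU : y ∈ U := hWU hyW
  have hG : ContDiffAt ℝ ∞ DU.coordKOn y :=
    (OpensChart.contMDiffAt_bilinSection_iff ⟨y, hyU⟩ DU.k DU.coordKOn
      (fun z ↦ (DU.coordKOn_of_mem z.2).symm)).1 (DU.contMDiff_k ⟨y, hyU⟩)
  refine hG.congr_of_eventuallyEq ?_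
  filter_upwards [hWo.mem_nhds hyW] with z hz
  ext v w
  rw [hag z (hWU hz) hz v w, DU.coordKOn_of_mem (hWU hz)]
  rfl

/-- A map `E3 → (E3 →L E3 →L ℝ)` which is `C^∞` everywhere is a `C^∞` section of the bundle of bilinear
forms on `TE3` (the tangent bundle of the model space is trivial, `contMDiffAt_bilinE3_iff`). [folklore] -/
theorem contMDiff_bilinSection_E3 {s : E3 → E3 →L[ℝ] E3 →L[ℝ] ℝ} (hs : ∀ y, ContDiffAt ℝ ∞ s y) :
    ContMDiff (𝓡 3) ((𝓡 3).prod 𝓘(ℝ, E3 →L[ℝ] E3 →L[ℝ] ℝ)) ∞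
      (fun y : E3 ↦ TotalSpace.mk' (E3 →L[ℝ] E3 →L[ℝ] ℝ)
        (E := fun x : E3 ↦ TangentSpace (𝓡 3) x →L[ℝ] TangentSpace (𝓡 3) x →L[ℝ] ℝ) y (s y)) := fun y ↦
  (contMDiffAt_bilinE3_iff (b := fun y : E3 ↦ y) (s := s)).2 ⟨contMDiffAt_id, (hs y).contMDiffAt⟩

/-- **Gluing an initial data set on `E3` from local models.** Let `(h, k)` be total fields of bilinear forms
on `E3` such that every point `y` has an open neighbourhood `W`, contained in a chart domain `U`, and a
VACUUM initial data set `D_U` on `U` whose sections agree with `(h, k)` on `W`. Then `(h, k)` are the sections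
of an initial data set on `E3` which solves the vacuum constraints (the constraint functions at `y` only
see the germ of the data at `y`, and are natural under the inclusion `U ⊆ E3`; Bartnik–Isenberg 2004, §2).
[cite: BartnikIsenberg2004, §2] -/
theorem exists_initialDataSet_of_localData
    (hloc : ∀ y : E3, ∃ (U : Opens E3) (DU : InitialDataSet 𝓘(ℝ, E3) U) (W : Set E3),
      IsOpen W ∧ y ∈ W ∧ W ⊆ U ∧ (∀ [DU.metric.HasLeviCivita], DU.IsVacuumConstraintSolution) ∧
      ∀ z (hz : z ∈ U), z ∈ W →
        (∀ v w, hF z v w = DU.h.inner ⟨z, hz⟩ v w) ∧ (∀ v w, kF z v w = DU.k ⟨z, hz⟩ v w)) :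
    ∃ D : InitialDataSet (𝓡 3) E3,
      (∀ y v w, D.h.inner y v w = hF y v w) ∧ (∀ y v w, D.k y v w = kF y v w) ∧
      ∀ [D.metric.HasLeviCivita], D.IsVacuumConstraintSolution := by
  -- pointwise algebra and smoothness of the two fields
  have hsymm : ∀ y v w, hF y v w = hF y w v := fun y v w ↦ by
    obtain ⟨U, DU, W, -, hyW, hWU, -, hag⟩ := hloc y
    rw [(hag y (hWU hyW) hyW).1 v w, (hag y (hWU hyW) hyW).1 w v]
    exact DU.h.symm _ v w
  have hpos : ∀ y v, v ≠ 0 → 0 < hF y v v := fun y v hv ↦ by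
    obtain ⟨U, DU, W, -, hyW, hWU, -, hag⟩ := hloc y
    rw [(hag y (hWU hyW) hyW).1 v v]
    exact DU.h.pos _ v hv
  have hksymm : ∀ y v w, kF y v w = kF y w v := fun y v w ↦ by
    obtain ⟨U, DU, W, -, hyW, hWU, -, hag⟩ := hloc y
    rw [(hag y (hWU hyW) hyW).2 v w, (hag y (hWU hyW) hyW).2 w v]
    exact DU.k_symm _ v w
  have hhs : ∀ y, ContDiffAt ℝ ∞ hF y := fun y ↦ by
    obtain ⟨U, DU, W, hWo, hyW, hWU, -, hag⟩ := hloc y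
    exact contDiffAt_of_localData_h DU hWo hyW hWU fun z hz hzW ↦ (hag z hz hzW).1
  have hks : ∀ y, ContDiffAt ℝ ∞ kF y := fun y ↦ by
    obtain ⟨U, DU, W, hWo, hyW, hWU, -, hag⟩ := hloc y
    exact contDiffAt_of_localData_k DU hWo hyW hWU fun z hz hzW ↦ (hag z hz hzW).2
  -- the glued datum
  let D : InitialDataSet (𝓡 3) E3 :=
    { h :=
        { inner := fun y ↦ hF y
          symm := fun y v w ↦ hsymm y v w
          pos := fun y v hv ↦ hpos y v hv
          isVonNBounded := fun y ↦
            PseudoRiemannianMetric.IsSpacelikeImmersion.isVonNBounded_setOf_lt_one_of_pos (V := E3) (hF y)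
              (hpos y)
          contMDiff := contMDiff_bilinSection_E3 hhs }
      k := fun y ↦ kF y
      k_symm := fun y v w ↦ hksymm y v w
      contMDiff_k := contMDiff_bilinSection_E3 hks }
  refine ⟨D, fun _ _ _ ↦ rfl, fun _ _ _ ↦ rfl, ?_⟩
  -- the vacuum constraints at `y`, transferred from the local model through the inclusion `U ⊆ E3`
  intro _ y
  obtain ⟨U, DU, W, hWo, hyW, hWU, hvac, hag⟩ := hloc y
  have hyU : y ∈ U := hWU hyW
  haveI hLU : DU.metric.HasLeviCivita := PseudoRiemannianMetric.hasLeviCivita _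
  haveI hLc : (D.comap (Subtype.val : U → E3) (InitialDataSet.contMDiff_subtypeVal_succ U)
      (InitialDataSet.injective_mfderiv_subtypeVal U)).metric.HasLeviCivita :=
    PseudoRiemannianMetric.hasLeviCivita _
  have hev : ∀ᶠ u : U in 𝓝 (⟨y, hyU⟩ : U), (u : E3) ∈ W :=
    continuous_subtype_val.continuousAt.preimage_mem_nhds (hWo.mem_nhds hyW)
  have hh : ∀ᶠ u : U in 𝓝 (⟨y, hyU⟩ : U),
      (D.comap (Subtype.val : U → E3) (InitialDataSet.contMDiff_subtypeVal_succ U)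
        (InitialDataSet.injective_mfderiv_subtypeVal U)).h.inner u = DU.h.inner u := by
    filter_upwards [hev] with u hu
    ext v w
    rw [InitialDataSet.comap_h_inner, OpenSubmanifold.mfderiv_subtype_val]
    exact (hag u u.2 hu).1 v w
  have hk : ∀ᶠ u : U in 𝓝 (⟨y, hyU⟩ : U),
      (D.comap (Subtype.val : U → E3) (InitialDataSet.contMDiff_subtypeVal_succ U)
        (InitialDataSet.injective_mfderiv_subtypeVal U)).k u = DU.k u := by
    filter_upwards [hev] with u hu
    ext v w
    rw [InitialDataSet.comap_k, OpenSubmanifold.mfderiv_subtype_val]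
    exact (hag u u.2 hu).2 v w
  have h1 := InitialDataSet.isVacuumAt_comap_iff D (InitialDataSet.contMDiff_subtypeVal_succ U)
    (InitialDataSet.injective_mfderiv_subtypeVal U) (⟨y, hyU⟩ : U)
  have h2 := InitialDataSet.isVacuumAt_congr (x := (⟨y, hyU⟩ : U)) hh hk
  exact h1.1 (h2.2 (hvac ⟨y, hyU⟩))

end Glue

end Assembly

/-- **Registered export of this file** (sub-goal `assembly_glue` of stub `stub_assembly`): gluing an initial data
set on `E3` from vacuum local models, `Assembly.exists_initialDataSet_of_localData`. [cite: BartnikIsenberg2004, §2] -/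
theorem assembly_glue :
    ∀ (hF kF : E3 → E3 →L[ℝ] E3 →L[ℝ] ℝ), (∀ y : E3, ∃ (U : TopologicalSpace.Opens E3) (DU : InitialDataSet 𝓘(ℝ, E3) U) (W : Set E3), IsOpen W ∧ y ∈ W ∧ W ⊆ U ∧ (∀ [DU.metric.HasLeviCivita], DU.IsVacuumConstraintSolution) ∧ ∀ z (hz : z ∈ U), z ∈ W → (∀ v w, hF z v w = DU.h.inner ⟨z, hz⟩ v w) ∧ (∀ v w, kF z v w = DU.k ⟨z, hz⟩ v w)) → ∃ D : InitialDataSet (𝓡 3) E3, (∀ y v w, D.h.inner y v w = hF y v w) ∧ (∀ y v w, D.k y v w = kF y v w) ∧ ∀ [D.metric.HasLeviCivita], D.IsVacuumConstraintSolution :=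
  fun _ _ hloc ↦ Assembly.exists_initialDataSet_of_localData hloc

end Summit.FinalStateConjecture.FinalStateConjecture.Theorems.SwallowTheDatum

end
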